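import Mathlib
import HarnessLib
import Literature.Analysis.FluidPDE.SelfSimilar
import Literature.Analysis.FluidPDE.LocalTypeI
import Literature.Analysis.FluidPDE.VectorCalculus
import Literature.Analysis.FluidPDE.TypeIAncientMild
import Literature.Analysis.FluidPDE.TypeIAncientMildClassical
import Literature.Analysis.FluidPDE.ClassicalLocalEnergyCutoff
import Literature.Analysis.FluidPDE.WholeSpaceIBP
import Literature.Analysis.FluidPDE.MildSolutionProofs
import Summits.NavierStokesRegularity.NavierStokesRegularity.Theorems.PoloidalWindowDoorPoloidalWindowRigidityWindow

/-!
# Route `PoloidalWindowDoor`, crux `PoloidalWindowRigidity` (K2, stmt-NavierStokesRegularity-19708) —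
# LARGE-SCALE ENERGY DECAY of the Type-I mild class (whole class), conditionally on a BMO-type bound for the class pressure

Cell ns-regularity-ideate, seat ns-poloidal-K2-p1 (K2 lead, gen 2; `--supports stmt-…-19708 --as helper`; K2P1-M11-NOTES §5).
For a profile `v` of the route's Type-I class (`‖v(t)‖ ≤ C/√(−t)`, continuous, unit-viscosity Oseen-mild, divergence free),

  `∫_{B̄_R} |v(t,x)|² dx ≤ K · (1/(−t) + 1 + 1/√(−t)) / R · |B̄_R|`     (`R ≥ 1`, `t < 0`),

PROVIDED the classical pressure of the class (`IsTypeIAncientMild.exists_isClassicalNSSolutionOn_Ioo`) has mean oscillation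
on balls bounded with the Type-I rate, `∫_{B̄_R}|p(s) − c| ≤ A/(−s)·|B̄_R|` for some `c = c(s,R)` — hypothesis `hBMO`, i.e. the
Calderón–Zygmund fact «`p(s) = Σ ℛᵢℛⱼ(vᵢvⱼ)(s)` mod constants, `‖p(s)‖_BMO ≲ ‖v(s)‖²_∞`» (KNSS 2009 §2; Stein 1993 IV §4.1), not
yet in the tree; it is exactly what the Oseen-mild identity (M) adds over the drifting non-mild witnesses of the negative lane.
PROOF: the tree's integrated local energy identity against the cut-off `χ_R` (`IsClassicalNSSolutionOn.local_energy_identity_cutoff`,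
`cutoff`, `‖Dχ_R‖ ≤ C₁/R`, `|Δχ_R| ≤ C₂/R²`) between the ANCIENT time `t₁ = R·t` and `t`; drop the dissipation; the fluxes are
`≤ |B̄_{2R}|(C₂C²/R + 2C₁(C³ + 2CA)/(R√(−t)))` (the pressure enters through `p − c` only: `∫ Dχ_R(v) = 0`), `∫χ_R|v(t₁)|² ≤ C²|B̄_{2R}|/(R(−t))`,
and `|B̄_{2R}| = 8|B̄_R|`.  So Type-I profiles are «at most sheet-like» in `L²`-density on every slice; the corollary «mean energy → 0»
(which kills e.g. one spatially periodic slice in one line) is in the sibling file `…LargeScaleEnergyLimit`.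

WHAT THIS IS NOT: not a claim about Navier–Stokes regularity and not the open residue S2⁗ — an averaged spatial-decay theorem for
the bare Type-I class (tubes and sheets have density zero), conditional on one classical Calderón–Zygmund input (bears_on LADDER-NS N0).
-/

noncomputable section

-- the summit and its single sub-problem share the name (CONVENTIONS §1), as in every Theorems file
set_option linter.dupNamespace false

namespace Summit.NavierStokesRegularity.NavierStokesRegularity.Theorems.PoloidalWindowDoorPoloidalWindowRigidityLargeScaleEnergy

open MeasureTheory Set Function Filter Topology Metric
open scoped RealInnerProductSpace InnerProductSpace Laplacian ContDiff
open Literature.Analysis Literature.Analysis.FluidPDE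
open Summit.NavierStokesRegularity.NavierStokesRegularity.Theorems.PoloidalWindowDoorPoloidalWindowRigidityWindow

/-- `∫ Dχ_R(x)(u x) dx = 0` for a divergence-free `C¹` field `u` (`∫ χ div u + ∫ ⟪u, ∇χ⟫ = 0`, tree
`integral_mul_divergence_add_eq_zero_left`). -/
theorem integral_fderiv_cutoff_apply_eq_zero {u : (EuclideanSpace ℝ (Fin 3)) → (EuclideanSpace ℝ (Fin 3))} (hu : ContDiff ℝ 1 u)
    (hdiv : VectorCalculus.IsDivFree u) {R : ℝ} (hR : 0 < R) :
    ∫ x, fderiv ℝ (cutoff R) x (u x) = 0 := by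
  have h := integral_mul_divergence_add_eq_zero_left (contDiff_cutoff (n := 1) R) hu
    (hasCompactSupport_cutoff hR)
  have h0 : (fun x => cutoff R x * VectorCalculus.divergence u x) = fun _ => (0 : ℝ) := by
    funext x; rw [hdiv x, mul_zero]
  rw [h0, integral_zero, zero_add] at h
  have h1 : (fun x => fderiv ℝ (cutoff R) x (u x)) = fun x => ⟪u x, gradient (cutoff R) x⟫ := by
    funext x
    rw [real_inner_comm, gradient, InnerProductSpace.toDual_symm_apply]
  rw [h1, h]

/-- `s ↦ 1/((−s)√(−s))` is continuous on `[a, b]` for `b < 0`. -/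
theorem continuousOn_inv_mul_sqrt {a b : ℝ} (hb : b < 0) (hab : a ≤ b) :
    ContinuousOn (fun s : ℝ => 1 / ((-s) * Real.sqrt (-s))) (uIcc a b) := by
  rw [uIcc_of_le hab]
  refine ContinuousOn.div continuousOn_const (continuousOn_neg.mul continuousOn_neg.sqrt) fun s hs => ?_
  have hs0 : 0 < -s := by linarith [hs.2]
  exact (mul_pos hs0 (Real.sqrt_pos.2 hs0)).ne'

/-- `∫_{Rt}^{t} ds / ((−s)√(−s)) ≤ 2/√(−t)` for `t < 0`, `R ≥ 1` (antiderivative `2/√(−s)`). -/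
theorem integral_inv_mul_sqrt_le {t : ℝ} (ht : t < 0) {R : ℝ} (hR : 1 ≤ R) :
    ∫ s in (R * t)..t, 1 / ((-s) * Real.sqrt (-s)) ≤ 2 / Real.sqrt (-t) := by
  have hRt : R * t ≤ t := by nlinarith
  have hderiv : ∀ s ∈ uIcc (R * t) t, HasDerivAt (fun σ => 2 / Real.sqrt (-σ))
      (1 / ((-s) * Real.sqrt (-s))) s := by
    intro s hs
    rw [uIcc_of_le hRt] at hs
    have hs0 : 0 < -s := by linarith [hs.2]
    have hsq : 0 < Real.sqrt (-s) := Real.sqrt_pos.2 hs0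
    have h1 : HasDerivAt (fun σ : ℝ => -σ) (-1) s := hasDerivAt_neg s
    have h2 : HasDerivAt (fun σ : ℝ => Real.sqrt (-σ)) (-1 / (2 * Real.sqrt (-s))) s := by
      simpa using h1.sqrt hs0.ne'
    have h3 := (h2.inv hsq.ne').const_mul 2
    have hss : Real.sqrt (-s) ^ 2 = -s := Real.sq_sqrt hs0.le
    refine (h3.congr_of_eventuallyEq (Eventually.of_forall fun σ => ?_)).congr_deriv ?_
    · simp [div_eq_mul_inv]
    · rw [hss]; field_simp
  have hcont : ContinuousOn (fun s : ℝ => 1 / ((-s) * Real.sqrt (-s))) (uIcc (R * t) t) :=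
    continuousOn_inv_mul_sqrt ht hRt
  have hint : IntervalIntegrable (fun s : ℝ => 1 / ((-s) * Real.sqrt (-s))) volume (R * t) t :=
    hcont.intervalIntegrable
  rw [intervalIntegral.integral_eq_sub_of_hasDerivAt hderiv hint]
  have hpos : 0 ≤ 2 / Real.sqrt (-(R * t)) := by positivity
  linarith

/-- `|B̄_{2R}| = 8 |B̄_R|` in `(EuclideanSpace ℝ (Fin 3))`. -/
theorem volume_closedBall_two_mul {R : ℝ} (hR : 0 ≤ R) :
    (volume (closedBall (0 : (EuclideanSpace ℝ (Fin 3))) (2 * R))).toReal = 8 * (volume (closedBall (0 : (EuclideanSpace ℝ (Fin 3))) R)).toReal := by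
  rw [Measure.addHaar_closedBall volume (0 : (EuclideanSpace ℝ (Fin 3))) (by positivity : (0 : ℝ) ≤ 2 * R),
    Measure.addHaar_closedBall volume (0 : (EuclideanSpace ℝ (Fin 3))) hR, ENNReal.toReal_mul, ENNReal.toReal_mul,
    ENNReal.toReal_ofReal (by positivity), ENNReal.toReal_ofReal (by positivity), finrank_euclideanSpace_fin]
  ring

variable {C : ℝ} {v : ℝ → (EuclideanSpace ℝ (Fin 3)) → (EuclideanSpace ℝ (Fin 3))}

set_option maxHeartbeats 400000 in
/-- **LARGE-SCALE ENERGY DECAY OF THE TYPE-I MILD CLASS** (conditional on the mean-oscillation bound `hBMO` for the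
class pressure).  For a profile of the route's Type-I class there is `K ≥ 0` with
`∫_{B̄_R} |v(t)|² ≤ K (1/(−t) + 1 + 1/√(−t)) / R · |B̄_R|` for all `t < 0`, `R ≥ 1`: the mean kinetic energy over large
balls tends to zero on EVERY slice (the energy in `B̄_R` grows at most like `R²`, not `R³`). -/
theorem exists_largeScale_energy_bound (hrate : HasTypeITimeDecay C v)
    (hcont : ContinuousOn (uncurry v) (Iio (0 : ℝ) ×ˢ univ))
    (hmild : ∀ s t : ℝ, s < t → t < 0 → ∀ x,
      v t x = UnboundedOperators.heatExtension (v s) (t - s) x - oseenDuhamel 1 s v v t x)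
    (hdiv : ∀ t < 0, VectorCalculus.IsDivFree (v t)) {A : ℝ} (hA : 0 ≤ A)
    (hBMO : ∀ t₀ < 0, ∀ p : ℝ → (EuclideanSpace ℝ (Fin 3)) → ℝ, IsClassicalNSSolutionOn (Ioo t₀ 0) 1 0 v p →
      ∀ s, t₀ < s → s < 0 → ∀ R : ℝ, 0 < R → ∃ c : ℝ,
        ∫ x in closedBall (0 : (EuclideanSpace ℝ (Fin 3))) R, |p s x - c| ≤ A / (-s) * (volume (closedBall (0 : (EuclideanSpace ℝ (Fin 3))) R)).toReal) :
    ∃ K : ℝ, 0 ≤ K ∧ ∀ t < 0, ∀ R : ℝ, 1 ≤ R →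
      ∫ x in closedBall (0 : (EuclideanSpace ℝ (Fin 3))) R, ‖v t x‖ ^ 2 ≤
        K * ((1 / (-t) + 1 + 1 / Real.sqrt (-t)) / R) * (volume (closedBall (0 : (EuclideanSpace ℝ (Fin 3))) R)).toReal := by
  have hAM : IsTypeIAncientMild C v := isTypeIAncientMild_of_class hrate hcont hmild hdiv
  obtain ⟨C₁, hC₁0, hC₁⟩ := exists_norm_fderiv_cutoff_le (E := (EuclideanSpace ℝ (Fin 3)))
  obtain ⟨C₂, hC₂0, hC₂⟩ := exists_abs_laplacian_cutoff_le (E := (EuclideanSpace ℝ (Fin 3)))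
  have hC0 : 0 ≤ C := by
    have h := hrate (-1) (by norm_num) 0
    rw [neg_neg, Real.sqrt_one, div_one] at h
    exact (norm_nonneg _).trans h
  refine ⟨8 * (C ^ 2 + C₂ * C ^ 2 + 2 * C₁ * (C ^ 3 + 2 * C * A)), by positivity, fun t ht R hR => ?_⟩
  have hR0 : 0 < R := by linarith
  have ht0 : 0 < -t := neg_pos.2 ht
  have hsqt : 0 < Real.sqrt (-t) := Real.sqrt_pos.2 ht0
  -- the ancient time `t₁ = R t` and a window `(R t − 1, 0)` carrying a classical pressure
  set t₁ : ℝ := R * t with ht₁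
  have ht₁t : t₁ ≤ t := by rw [ht₁]; nlinarith
  have ht₁0 : t₁ < 0 := by rw [ht₁]; nlinarith
  have hwin : R * t - 1 < 0 := by linarith
  obtain ⟨p, hp⟩ := hAM.exists_isClassicalNSSolutionOn_Ioo hwin
  have hI : Icc t₁ t ⊆ Ioo (R * t - 1) 0 := fun s hs => ⟨by rw [ht₁] at hs; linarith [hs.1], by linarith [hs.2]⟩
  -- the cut-off `χ_R` and the integrated local energy identity on `[t₁, t]`
  set φ : (EuclideanSpace ℝ (Fin 3)) → ℝ := cutoff R with hφ
  have hφs : ContDiff ℝ ∞ φ := contDiff_cutoff R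
  have hφc : HasCompactSupport φ := hasCompactSupport_cutoff hR0
  have hid := hp.local_energy_identity_cutoff isOpen_Ioo hφs hφc ht₁t hI
  set VR : ℝ := (volume (closedBall (0 : (EuclideanSpace ℝ (Fin 3))) R)).toReal with hVR
  set V2 : ℝ := (volume (closedBall (0 : (EuclideanSpace ℝ (Fin 3))) (2 * R))).toReal with hV2
  have hV2eq : V2 = 8 * VR := volume_closedBall_two_mul hR0.le
  have hVR0 : 0 ≤ VR := ENNReal.toReal_nonneg
  have hV2fin : volume (closedBall (0 : (EuclideanSpace ℝ (Fin 3))) (2 * R)) < ⊤ := measure_closedBall_lt_top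
  -- pointwise facts about the cut-off
  have hφ01 : ∀ x, 0 ≤ φ x ∧ φ x ≤ 1 := fun x => ⟨cutoff_nonneg R x, cutoff_le_one R x⟩
  have hφ1 : ∀ x ∈ closedBall (0 : (EuclideanSpace ℝ (Fin 3))) R, φ x = 1 := fun x hx =>
    cutoff_eq_one hR0 (by simpa using hx)
  have hφsupp : ∀ x, x ∉ closedBall (0 : (EuclideanSpace ℝ (Fin 3))) (2 * R) → φ x = 0 := fun x hx =>
    cutoff_eq_zero hR0 (by rw [mem_closedBall, dist_zero_right, not_le] at hx; exact hx.le)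
  have htsupp : tsupport φ ⊆ closedBall (0 : (EuclideanSpace ℝ (Fin 3))) (2 * R) := tsupport_cutoff_subset hR0
  have hDφsupp : ∀ x, x ∉ closedBall (0 : (EuclideanSpace ℝ (Fin 3))) (2 * R) → fderiv ℝ φ x = 0 := fun x hx =>
    fderiv_of_notMem_tsupport ℝ (fun h => hx (htsupp h))
  have hΔφsupp : ∀ x, x ∉ closedBall (0 : (EuclideanSpace ℝ (Fin 3))) (2 * R) → (Δ φ) x = 0 := fun x hx =>
    laplacian_eq_zero_of_notMem_tsupport (fun h => hx (htsupp h))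
  have hDφ : ∀ x, ‖fderiv ℝ φ x‖ ≤ C₁ / R := fun x => hC₁ R hR0 x
  have hΔφ : ∀ x, |(Δ φ) x| ≤ C₂ / R ^ 2 := fun x => hC₂ R hR0 x
  have hvb : ∀ s, s < 0 → ∀ x, ‖v s x‖ ≤ C / Real.sqrt (-s) := fun s hs x => hrate s hs x
  have hvc : ∀ s ∈ Ioo (R * t - 1) 0, Continuous (v s) := fun s hs =>
    (hp.contDiff_velocity hs).continuous
  have hpc : ∀ s ∈ Ioo (R * t - 1) 0, Continuous (p s) := fun s hs =>
    (hp.contDiff_pressure hs).continuous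
  -- (i) `∫_{B̄_R} |v(t)|² ≤ ∫ φ |v(t)|²`
  have htI : t ∈ Ioo (R * t - 1) 0 := hI ⟨ht₁t, le_rfl⟩
  have hφv_int : ∀ s ∈ Ioo (R * t - 1) 0, Integrable (fun x => φ x * ‖v s x‖ ^ 2) := fun s hs =>
    ((contDiff_cutoff (n := 0) R).continuous.mul ((hvc s hs).norm.pow 2)).integrable_of_hasCompactSupport
      hφc.mul_right
  have step1 : ∫ x in closedBall (0 : (EuclideanSpace ℝ (Fin 3))) R, ‖v t x‖ ^ 2 ≤ ∫ x, φ x * ‖v t x‖ ^ 2 := by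
    calc ∫ x in closedBall (0 : (EuclideanSpace ℝ (Fin 3))) R, ‖v t x‖ ^ 2
        = ∫ x in closedBall (0 : (EuclideanSpace ℝ (Fin 3))) R, φ x * ‖v t x‖ ^ 2 :=
          setIntegral_congr_fun measurableSet_closedBall fun x hx => by rw [hφ1 x hx, one_mul]
      _ ≤ ∫ x, φ x * ‖v t x‖ ^ 2 :=
          setIntegral_le_integral (hφv_int t htI) (Eventually.of_forall fun x =>
            mul_nonneg (hφ01 x).1 (sq_nonneg _))
  -- (ii) `∫ φ |v(t₁)|² ≤ C² V2 / (−t₁)`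
  have ht₁I : t₁ ∈ Ioo (R * t - 1) 0 := hI ⟨le_rfl, ht₁t⟩
  have step2 : ∫ x, φ x * ‖v t₁ x‖ ^ 2 ≤ C ^ 2 / (-t₁) * V2 := by
    have hzero : ∀ x, x ∉ closedBall (0 : (EuclideanSpace ℝ (Fin 3))) (2 * R) → φ x * ‖v t₁ x‖ ^ 2 = 0 := fun x hx => by
      rw [hφsupp x hx, zero_mul]
    rw [← setIntegral_eq_integral_of_forall_compl_eq_zero (fun x hx => hzero x hx)]
    have hbd : ∀ x ∈ closedBall (0 : (EuclideanSpace ℝ (Fin 3))) (2 * R), ‖φ x * ‖v t₁ x‖ ^ 2‖ ≤ C ^ 2 / (-t₁) := by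
      intro x _
      rw [Real.norm_eq_abs, abs_of_nonneg (mul_nonneg (hφ01 x).1 (sq_nonneg _))]
      have h1 : ‖v t₁ x‖ ^ 2 ≤ (C / Real.sqrt (-t₁)) ^ 2 :=
        pow_le_pow_left₀ (norm_nonneg _) (hvb t₁ ht₁0 x) 2
      have h2 : (C / Real.sqrt (-t₁)) ^ 2 = C ^ 2 / (-t₁) := by
        rw [div_pow, Real.sq_sqrt (neg_pos.2 ht₁0).le]
      calc φ x * ‖v t₁ x‖ ^ 2 ≤ 1 * (C / Real.sqrt (-t₁)) ^ 2 :=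
            mul_le_mul (hφ01 x).2 h1 (sq_nonneg _) zero_le_one
        _ = C ^ 2 / (-t₁) := by rw [one_mul, h2]
    have h := norm_setIntegral_le_of_norm_le_const hV2fin hbd
    rw [Real.norm_eq_abs] at h
    have := le_of_abs_le h
    simpa [hV2, measureReal_def] using this
  -- (iii) the dissipation term is nonnegative
  have step3 : 0 ≤ 2 * (1 : ℝ) * ∫ s in t₁..t, ∫ x, frobeniusNormSq (fderiv ℝ (v s) x) * φ x := by
    have hin : ∀ s, 0 ≤ ∫ x, frobeniusNormSq (fderiv ℝ (v s) x) * φ x := fun s =>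
      integral_nonneg fun x => mul_nonneg (frobeniusNormSq_nonneg _) (hφ01 x).1
    have := intervalIntegral.integral_nonneg (μ := volume) ht₁t fun s _ => hin s
    positivity
  -- (iv) the flux bound, slice by slice
  set flux : ℝ → ℝ := fun s => ∫ x, ((1 : ℝ) * ((Δ φ) x * ‖v s x‖ ^ 2) +
    fderiv ℝ φ x (v s x) * ‖v s x‖ ^ 2 + 2 * (p s x * fderiv ℝ φ x (v s x))) with hflux
  set b : ℝ → ℝ := fun s => V2 * (C₂ * C ^ 2 / (R ^ 2 * (-t)) +
    (C₁ * C ^ 3 + 2 * C₁ * C * A) / R * (1 / ((-s) * Real.sqrt (-s)))) with hb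
  have hslice : ∀ s ∈ Icc t₁ t, flux s ≤ b s := by
    intro s hs
    have hsI : s ∈ Ioo (R * t - 1) 0 := hI hs
    have hs0 : s < 0 := hsI.2
    have hns : 0 < -s := neg_pos.2 hs0
    have hsq : 0 < Real.sqrt (-s) := Real.sqrt_pos.2 hns
    have hst : -t ≤ -s := by linarith [hs.2]
    obtain ⟨c, hc⟩ := hBMO (R * t - 1) hwin p hp s hsI.1 hs0 (2 * R) (by linarith)
    -- continuity / integrability of the pieces
    have hvs : Continuous (v s) := hvc s hsI
    have hps : Continuous (p s) := hpc s hsI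
    have hDφc : Continuous fun x => fderiv ℝ φ x (v s x) :=
      ((contDiff_cutoff (n := 1) R).continuous_fderiv one_ne_zero).clm_apply hvs
    have hDφcs : HasCompactSupport fun x => fderiv ℝ φ x (v s x) := by
      refine HasCompactSupport.intro (isCompact_closedBall (0 : (EuclideanSpace ℝ (Fin 3))) (2 * R)) fun x hx => ?_
      simp [hDφsupp x hx]
    have hΔc : Continuous (Δ φ) := continuous_laplacian ((contDiff_cutoff (n := 2) R))
    set F : (EuclideanSpace ℝ (Fin 3)) → ℝ := fun x => (1 : ℝ) * ((Δ φ) x * ‖v s x‖ ^ 2) +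
      fderiv ℝ φ x (v s x) * ‖v s x‖ ^ 2 + 2 * ((p s x - c) * fderiv ℝ φ x (v s x)) with hF
    set G : (EuclideanSpace ℝ (Fin 3)) → ℝ := fun x => fderiv ℝ φ x (v s x) with hG
    have hGint : Integrable G := hDφc.integrable_of_hasCompactSupport hDφcs
    have hFc : Continuous F := by
      refine ((continuous_const.mul (hΔc.mul (hvs.norm.pow 2))).add (hDφc.mul (hvs.norm.pow 2))).add
        (continuous_const.mul ((hps.sub continuous_const).mul hDφc))
    have hFzero : ∀ x, x ∉ closedBall (0 : (EuclideanSpace ℝ (Fin 3))) (2 * R) → F x = 0 := fun x hx => by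
      simp [hF, hΔφsupp x hx, hDφsupp x hx]
    have hFcs : HasCompactSupport F :=
      HasCompactSupport.intro (isCompact_closedBall (0 : (EuclideanSpace ℝ (Fin 3))) (2 * R)) fun x hx => hFzero x hx
    have hFint : Integrable F := hFc.integrable_of_hasCompactSupport hFcs
    -- remove the constant part of the pressure: `flux s = ∫ F` since `∫ G = 0`
    have hG0 : ∫ x, G x = 0 :=
      integral_fderiv_cutoff_apply_eq_zero ((hp.contDiff_velocity hsI).of_le (by norm_cast)) (hp.divFree s hsI) hR0
    have hfluxF : flux s = ∫ x, F x := by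
      have hsplit : (fun x => (1 : ℝ) * ((Δ φ) x * ‖v s x‖ ^ 2) + fderiv ℝ φ x (v s x) * ‖v s x‖ ^ 2 +
          2 * (p s x * fderiv ℝ φ x (v s x))) = fun x => F x + (2 * c) * G x := by
        funext x; simp only [hF, hG]; ring
      simp only [hflux]
      rw [hsplit, integral_add hFint (hGint.const_mul _), integral_const_mul, hG0, mul_zero, add_zero]
    -- pointwise bound of `F` on the ball by `α + β |p − c|`
    set α : ℝ := C₂ / R ^ 2 * (C ^ 2 / (-t)) + C₁ / R * (C ^ 3 * (1 / ((-s) * Real.sqrt (-s)))) with hα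
    set β : ℝ := 2 * (C₁ / R * (C / Real.sqrt (-s))) with hβ
    have hvsx : ∀ x, ‖v s x‖ ≤ C / Real.sqrt (-s) := hvb s hs0
    have hv2 : ∀ x, ‖v s x‖ ^ 2 ≤ C ^ 2 / (-s) := fun x => by
      have := pow_le_pow_left₀ (norm_nonneg _) (hvsx x) 2
      rwa [div_pow, Real.sq_sqrt hns.le] at this
    have hv3 : ∀ x, ‖v s x‖ ^ 3 ≤ C ^ 3 * (1 / ((-s) * Real.sqrt (-s))) := fun x => by
      have h := pow_le_pow_left₀ (norm_nonneg _) (hvsx x) 3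
      have hden : (C / Real.sqrt (-s)) ^ 3 = C ^ 3 * (1 / ((-s) * Real.sqrt (-s))) := by
        have hss : Real.sqrt (-s) ^ 2 = -s := Real.sq_sqrt hns.le
        rw [div_pow, show Real.sqrt (-s) ^ 3 = Real.sqrt (-s) ^ 2 * Real.sqrt (-s) by ring, hss]
        ring
      rwa [hden] at h
    have hDφv : ∀ x, |fderiv ℝ φ x (v s x)| ≤ C₁ / R * ‖v s x‖ := fun x => by
      rw [← Real.norm_eq_abs]
      exact (ContinuousLinearMap.le_opNorm _ _).trans (mul_le_mul_of_nonneg_right (hDφ x) (norm_nonneg _))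
    have hFpt : ∀ x, |F x| ≤ α + β * |p s x - c| := by
      intro x
      have h1 : |(1 : ℝ) * ((Δ φ) x * ‖v s x‖ ^ 2)| ≤ C₂ / R ^ 2 * (C ^ 2 / (-t)) := by
        rw [one_mul, abs_mul, abs_of_nonneg (sq_nonneg ‖v s x‖)]
        refine mul_le_mul (hΔφ x) ((hv2 x).trans ?_) (sq_nonneg _) (by positivity)
        exact div_le_div_of_nonneg_left (sq_nonneg C) ht0 hst
      have h2 : |fderiv ℝ φ x (v s x) * ‖v s x‖ ^ 2| ≤ C₁ / R * (C ^ 3 * (1 / ((-s) * Real.sqrt (-s)))) := by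
        rw [abs_mul, abs_of_nonneg (sq_nonneg ‖v s x‖)]
        calc |fderiv ℝ φ x (v s x)| * ‖v s x‖ ^ 2 ≤ (C₁ / R * ‖v s x‖) * ‖v s x‖ ^ 2 :=
              mul_le_mul_of_nonneg_right (hDφv x) (sq_nonneg _)
          _ = C₁ / R * ‖v s x‖ ^ 3 := by ring
          _ ≤ C₁ / R * (C ^ 3 * (1 / ((-s) * Real.sqrt (-s)))) :=
              mul_le_mul_of_nonneg_left (hv3 x) (by positivity)
      have h3 : |2 * ((p s x - c) * fderiv ℝ φ x (v s x))| ≤ β * |p s x - c| := by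
        rw [abs_mul, abs_mul, abs_of_pos (by norm_num : (0:ℝ) < 2), hβ]
        calc 2 * (|p s x - c| * |fderiv ℝ φ x (v s x)|) ≤ 2 * (|p s x - c| * (C₁ / R * ‖v s x‖)) := by
              gcongr; exact hDφv x
          _ ≤ 2 * (|p s x - c| * (C₁ / R * (C / Real.sqrt (-s)))) := by
              gcongr; exact hvsx x
          _ = 2 * (C₁ / R * (C / Real.sqrt (-s))) * |p s x - c| := by ring
      calc |F x| ≤ |(1 : ℝ) * ((Δ φ) x * ‖v s x‖ ^ 2)| + |fderiv ℝ φ x (v s x) * ‖v s x‖ ^ 2| +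
            |2 * ((p s x - c) * fderiv ℝ φ x (v s x))| := by
            simp only [hF]; exact abs_add_three _ _ _
        _ ≤ α + β * |p s x - c| := by rw [hα]; linarith
    -- integrate the pointwise bound over the ball
    have hpcint : IntegrableOn (fun x => |p s x - c|) (closedBall (0 : (EuclideanSpace ℝ (Fin 3))) (2 * R)) :=
      ((hps.sub continuous_const).abs).continuousOn.integrableOn_compact (isCompact_closedBall _ _)
    have hmajor : IntegrableOn (fun x => α + β * |p s x - c|) (closedBall (0 : (EuclideanSpace ℝ (Fin 3))) (2 * R)) :=
      (continuousOn_const.add (continuousOn_const.mul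
        ((hps.sub continuous_const).abs).continuousOn)).integrableOn_compact (isCompact_closedBall _ _)
    have hintF : ∫ x, F x = ∫ x in closedBall (0 : (EuclideanSpace ℝ (Fin 3))) (2 * R), F x :=
      (setIntegral_eq_integral_of_forall_compl_eq_zero (fun x hx => hFzero x hx)).symm
    have hFle : ∫ x in closedBall (0 : (EuclideanSpace ℝ (Fin 3))) (2 * R), F x ≤ ∫ x in closedBall (0 : (EuclideanSpace ℝ (Fin 3))) (2 * R), (α + β * |p s x - c|) := by
      refine setIntegral_mono_on hFint.integrableOn hmajor measurableSet_closedBall fun x _ => ?_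
      exact (le_abs_self _).trans (hFpt x)
    have hrhs : ∫ x in closedBall (0 : (EuclideanSpace ℝ (Fin 3))) (2 * R), (α + β * |p s x - c|) =
        α * V2 + β * ∫ x in closedBall (0 : (EuclideanSpace ℝ (Fin 3))) (2 * R), |p s x - c| := by
      rw [integral_add (integrableOn_const (C := α) (hs := hV2fin.ne)) (hpcint.const_mul β), integral_const_mul,
        setIntegral_const, smul_eq_mul, hV2, measureReal_def, mul_comm]
    have hβ0 : 0 ≤ β := by positivity
    have hV20 : 0 ≤ V2 := ENNReal.toReal_nonneg
    calc flux s = ∫ x, F x := hfluxF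
      _ = ∫ x in closedBall (0 : (EuclideanSpace ℝ (Fin 3))) (2 * R), F x := hintF
      _ ≤ α * V2 + β * ∫ x in closedBall (0 : (EuclideanSpace ℝ (Fin 3))) (2 * R), |p s x - c| := hFle.trans hrhs.le
      _ ≤ α * V2 + β * (A / (-s) * V2) := by gcongr
      _ = b s := by
          simp only [hb, hα, hβ]
          ring
  -- integrate the slice bound in time
  have hflux_cont : ContinuousOn flux (Ioo (R * t - 1) 0) := hp.continuousOn_integral_flux_cutoff hφs hφc
  have hflux_int : IntervalIntegrable flux volume t₁ t :=
    (hflux_cont.mono (by rw [uIcc_of_le ht₁t]; exact hI)).intervalIntegrable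
  have hq_cont : ContinuousOn (fun s : ℝ => 1 / ((-s) * Real.sqrt (-s))) (uIcc t₁ t) :=
    continuousOn_inv_mul_sqrt ht ht₁t
  have hq_int : IntervalIntegrable (fun s : ℝ => 1 / ((-s) * Real.sqrt (-s))) volume t₁ t :=
    hq_cont.intervalIntegrable
  have hb_cont : ContinuousOn b (uIcc t₁ t) :=
    continuousOn_const.mul (continuousOn_const.add (continuousOn_const.mul hq_cont))
  have hb_int : IntervalIntegrable b volume t₁ t := hb_cont.intervalIntegrable
  have step4a : ∫ s in t₁..t, flux s ≤ ∫ s in t₁..t, b s :=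
    intervalIntegral.integral_mono_on ht₁t hflux_int hb_int fun s hs => hslice s hs
  have step4b : ∫ s in t₁..t, b s ≤ V2 * (C₂ * C ^ 2 / R + 2 * (C₁ * C ^ 3 + 2 * C₁ * C * A) / (R * Real.sqrt (-t))) := by
    have hI1 : ∫ s in t₁..t, (1 : ℝ) / ((-s) * Real.sqrt (-s)) ≤ 2 / Real.sqrt (-t) := by
      rw [ht₁]; exact integral_inv_mul_sqrt_le ht hR
    have hsplit : ∫ s in t₁..t, b s = V2 * (C₂ * C ^ 2 / (R ^ 2 * (-t)) * (t - t₁) +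
        (C₁ * C ^ 3 + 2 * C₁ * C * A) / R * ∫ s in t₁..t, 1 / ((-s) * Real.sqrt (-s))) := by
      simp only [hb]
      rw [intervalIntegral.integral_const_mul,
        intervalIntegral.integral_add intervalIntegrable_const (hq_int.const_mul _),
        intervalIntegral.integral_const, intervalIntegral.integral_const_mul, smul_eq_mul]
      ring
    rw [hsplit]
    have hV20 : 0 ≤ V2 := ENNReal.toReal_nonneg
    refine mul_le_mul_of_nonneg_left ?_ hV20
    have hlen : t - t₁ ≤ R * (-t) := by rw [ht₁]; nlinarith
    have htne : t ≠ 0 := ht.ne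
    have hRne : R ≠ 0 := hR0.ne'
    have h1 : C₂ * C ^ 2 / (R ^ 2 * (-t)) * (t - t₁) ≤ C₂ * C ^ 2 / R := by
      calc C₂ * C ^ 2 / (R ^ 2 * (-t)) * (t - t₁) ≤ C₂ * C ^ 2 / (R ^ 2 * (-t)) * (R * (-t)) :=
            mul_le_mul_of_nonneg_left hlen (by positivity)
        _ = C₂ * C ^ 2 / R := by field_simp; try ring
    have h2 : (C₁ * C ^ 3 + 2 * C₁ * C * A) / R * ∫ s in t₁..t, 1 / ((-s) * Real.sqrt (-s)) ≤
        2 * (C₁ * C ^ 3 + 2 * C₁ * C * A) / (R * Real.sqrt (-t)) := by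
      calc (C₁ * C ^ 3 + 2 * C₁ * C * A) / R * ∫ s in t₁..t, 1 / ((-s) * Real.sqrt (-s))
          ≤ (C₁ * C ^ 3 + 2 * C₁ * C * A) / R * (2 / Real.sqrt (-t)) :=
            mul_le_mul_of_nonneg_left hI1 (by positivity)
        _ = 2 * (C₁ * C ^ 3 + 2 * C₁ * C * A) / (R * Real.sqrt (-t)) := by ring
    linarith
  -- (v) assemble
  have step4a' : intervalIntegral flux t₁ t volume ≤ ∫ s in t₁..t, b s := step4a
  have hid' : (∫ x, φ x * ‖v t x‖ ^ 2) - (∫ x, φ x * ‖v t₁ x‖ ^ 2) +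
      2 * (1 : ℝ) * ∫ s in t₁..t, ∫ x, frobeniusNormSq (fderiv ℝ (v s) x) * φ x = intervalIntegral flux t₁ t volume :=
    hid
  have hmain : ∫ x in closedBall (0 : (EuclideanSpace ℝ (Fin 3))) R, ‖v t x‖ ^ 2 ≤
      C ^ 2 / (-t₁) * V2 + V2 * (C₂ * C ^ 2 / R + 2 * (C₁ * C ^ 3 + 2 * C₁ * C * A) / (R * Real.sqrt (-t))) := by
    linarith only [hid', step1, step2, step3, step4a', step4b]
  have ht₁eq : -t₁ = R * (-t) := by rw [ht₁]; ring
  rw [ht₁eq, hV2eq] at hmain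
  -- compare with the advertised constant `8 S`, `S = C² + C₂C² + 2C₁(C³ + 2CA)`
  have hC3 : 0 ≤ C₁ * C ^ 3 := mul_nonneg hC₁0 (pow_nonneg hC0 3)
  have hCA : 0 ≤ C₁ * C * A := mul_nonneg (mul_nonneg hC₁0 hC0) hA
  have hC2' : 0 ≤ C₂ * C ^ 2 := mul_nonneg hC₂0 (sq_nonneg C)
  have hS1 : C ^ 2 ≤ C ^ 2 + C₂ * C ^ 2 + 2 * C₁ * (C ^ 3 + 2 * C * A) := by linarith
  have hS2 : C₂ * C ^ 2 ≤ C ^ 2 + C₂ * C ^ 2 + 2 * C₁ * (C ^ 3 + 2 * C * A) := by nlinarith [sq_nonneg C]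
  have hS3 : 2 * (C₁ * C ^ 3 + 2 * C₁ * C * A) ≤ C ^ 2 + C₂ * C ^ 2 + 2 * C₁ * (C ^ 3 + 2 * C * A) := by
    nlinarith [sq_nonneg C]
  have hinv : 0 ≤ 1 / (-t) := by positivity
  have hinvs : 0 ≤ 1 / Real.sqrt (-t) := by positivity
  calc ∫ x in closedBall (0 : (EuclideanSpace ℝ (Fin 3))) R, ‖v t x‖ ^ 2
      ≤ C ^ 2 / (R * (-t)) * (8 * VR) + 8 * VR * (C₂ * C ^ 2 / R +
          2 * (C₁ * C ^ 3 + 2 * C₁ * C * A) / (R * Real.sqrt (-t))) := hmain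
    _ = 8 * VR * ((C ^ 2) * (1 / (-t)) + (C₂ * C ^ 2) * 1 +
          (2 * (C₁ * C ^ 3 + 2 * C₁ * C * A)) * (1 / Real.sqrt (-t))) / R := by
        ring
    _ ≤ 8 * VR * ((C ^ 2 + C₂ * C ^ 2 + 2 * C₁ * (C ^ 3 + 2 * C * A)) * (1 / (-t)) +
          (C ^ 2 + C₂ * C ^ 2 + 2 * C₁ * (C ^ 3 + 2 * C * A)) * 1 +
          (C ^ 2 + C₂ * C ^ 2 + 2 * C₁ * (C ^ 3 + 2 * C * A)) * (1 / Real.sqrt (-t))) / R := by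
        have key : (C ^ 2) * (1 / (-t)) + (C₂ * C ^ 2) * 1 +
            (2 * (C₁ * C ^ 3 + 2 * C₁ * C * A)) * (1 / Real.sqrt (-t)) ≤
            (C ^ 2 + C₂ * C ^ 2 + 2 * C₁ * (C ^ 3 + 2 * C * A)) * (1 / (-t)) +
            (C ^ 2 + C₂ * C ^ 2 + 2 * C₁ * (C ^ 3 + 2 * C * A)) * 1 +
            (C ^ 2 + C₂ * C ^ 2 + 2 * C₁ * (C ^ 3 + 2 * C * A)) * (1 / Real.sqrt (-t)) :=
          add_le_add (add_le_add (mul_le_mul_of_nonneg_right hS1 hinv) (by linarith))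
            (mul_le_mul_of_nonneg_right hS3 hinvs)
        have h8 : 0 ≤ 8 * VR := by positivity
        exact div_le_div_of_nonneg_right (mul_le_mul_of_nonneg_left key h8) hR0.le
    _ = 8 * (C ^ 2 + C₂ * C ^ 2 + 2 * C₁ * (C ^ 3 + 2 * C * A)) *
          ((1 / (-t) + 1 + 1 / Real.sqrt (-t)) / R) * VR := by ring

end Summit.NavierStokesRegularity.NavierStokesRegularity.Theorems.PoloidalWindowDoorPoloidalWindowRigidityLargeScaleEnergy
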